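import Summits.ValiantsHypothesis.ValiantsHypothesis.Theorems.LacunarySymmetroidMatrixDescartesVSQGenStep0
import Summits.ValiantsHypothesis.ValiantsHypothesis.Theorems.LacunarySymmetroidMatrixDescartesVSQTriLaw

/-!
# `MatrixDescartes` census — the recursive tridiagonal family: the level-`0` point steps and the late-point core

HONEST FRAMING.  Val-V1-extremal engine seat val-v1x-eng-6 (g2), `--supports stmt-ValiantsHypothesis-18050` (helper).  For the
`(L+2)`-level system (`…VSQGenDefs`): the invariant bounds `2^{−(L+2)} Vv ≤ ss · fL ≤ 2^{L+2} Vv` at its level-`0` U-points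
(`stepP_U`), strong-link points (`stepP_W`), bracketed zeros of the link (`stepP_I`, square splitting), from the flat invariants
`INVf L`, `INVf (L+1)`; and the late-point core `late_core` (main term `a_{top}(t) · fL (L+1) (u)` against the error
`(B^{−δ} b(t))² fL L (u/B^σ)`), to which `…VSQGenInv` feeds the five late sub-cases.  Nothing here bears on the crux `MatrixDescartes`
(stmt-18050) or on `VP ≠ VNP`.
[folklore] Elementary.
-/

set_option linter.dupNamespace false
set_option autoImplicit false

namespace Summit.ValiantsHypothesis.ValiantsHypothesis.Theorems.LacunarySymmetroidMatrixDescartes.VSQ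

open scoped BigOperators
open Finset

variable {n : ℕ} {B : ℝ}

/-! ## 0. Unfolding the recursive data at `L + 2` -/

/-- `tp (L+2) j` for `j < 3n`. [folklore] -/
theorem tp_lt3 (n : ℕ) (B : ℝ) (L j : ℕ) (hj : j < 3 * n) : tp n B (L + 2) j = tau n B j := by
  simp only [tp, if_pos hj]
/-- `tp (L+2) j` for `j ≥ 3n`. [folklore] -/
theorem tp_ge3 (n : ℕ) (B : ℝ) (L j : ℕ) (hj : ¬ j < 3 * n) :
    tp n B (L + 2) j = B ^ (sg n : ℤ) * tp n B (L + 1) (j - 3 * n) := by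
  simp only [tp, if_neg hj]
/-- `ss (L+2) j`, U-points. [folklore] -/
theorem ss_U (n L j : ℕ) (hj : j < 3 * n) (hjn : j ≤ n) :
    ss n (L + 2) j = saR n j * ((-1) ^ n) ^ (L + 1) * sflat n (L + 1) := by
  simp only [ss, if_pos hj, if_pos hjn]
/-- `ss (L+2) j`, bracket points. [folklore] -/
theorem ss_I (n L j : ℕ) (hj : j < 3 * n) (hjn : ¬ j ≤ n) (hp : (j - n) % 2 = 0) :
    ss n (L + 2) j = ((-1) ^ n) ^ (L + 1) * sflat n (L + 1) := by
  simp only [ss, if_pos hj, if_neg hjn, if_pos hp]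
/-- `ss (L+2) j`, strong-link points. [folklore] -/
theorem ss_W (n L j : ℕ) (hj : j < 3 * n) (hjn : ¬ j ≤ n) (hp : ¬ (j - n) % 2 = 0) :
    ss n (L + 2) j = -sflat n L := by
  simp only [ss, if_pos hj, if_neg hjn, if_neg hp]
/-- `ss (L+2) j`, late points. [folklore] -/
theorem ss_late (n L j : ℕ) (hj : ¬ j < 3 * n) :
    ss n (L + 2) j = ((-1) ^ n) ^ (L + 1) * ss n (L + 1) (j - 3 * n) := by
  simp only [ss, if_neg hj]
/-- `Vv (L+2) j`, U-points. [folklore] -/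
theorem Vv_U (n : ℕ) (B : ℝ) (L j : ℕ) (hj : j < 3 * n) (hjn : j ≤ n) :
    Vv n B (L + 2) j = B ^ (ea n j (2 * (j : ℤ) - 1)) * B ^ (((L + 1 : ℕ) : ℤ) * qa n) := by
  simp only [Vv, if_pos hj, if_pos hjn]
/-- `Vv (L+2) j`, bracket points. [folklore] -/
theorem Vv_I (n : ℕ) (B : ℝ) (L j : ℕ) (hj : j < 3 * n) (hjn : ¬ j ≤ n) (hp : (j - n) % 2 = 0) :
    Vv n B (L + 2) j = tv B (haF n ⟨n, by omega⟩) (dF n ⟨n, by omega⟩) (bz n B ((j - n) / 2)) * B ^ (((L + 1 : ℕ) : ℤ) * qa n) := by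
  simp only [Vv, if_pos hj, if_neg hjn, if_pos hp]
/-- `Vv (L+2) j`, strong-link points. [folklore] -/
theorem Vv_W (n : ℕ) (B : ℝ) (L j : ℕ) (hj : j < 3 * n) (hjn : ¬ j ≤ n) (hp : ¬ (j - n) % 2 = 0) :
    Vv n B (L + 2) j = B ^ (2 * (eb n ((j - n + 1) / 2) ((j : ℤ) + n) - (dlt n : ℤ))) * B ^ (((L : ℕ) : ℤ) * qa n) := by
  simp only [Vv, if_pos hj, if_neg hjn, if_neg hp]
/-- `Vv (L+2) j`, late points. [folklore] -/
theorem Vv_late (n : ℕ) (B : ℝ) (L j : ℕ) (hj : ¬ j < 3 * n) :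
    Vv n B (L + 2) j = tv B (haF n (Fin.last (n + 1))) (dF n (Fin.last (n + 1))) (tp n B (L + 2) j) * Vv n B (L + 1) (j - 3 * n) := by
  simp only [Vv, if_neg hj]

/-- bounds scale from `[lo/2, 2hi]` at `(L+1)` to `[2^{-(L+2)}, 2^{L+2}]`. [folklore] -/
theorem bounds_rescale {X V : ℝ} (L : ℕ)
    (h : (1 / 2 : ℝ) ^ (L + 1) / 2 * V ≤ X ∧ X ≤ 2 * (2 : ℝ) ^ (L + 1) * V) :
    (1 / 2 : ℝ) ^ (L + 2) * V ≤ X ∧ X ≤ (2 : ℝ) ^ (L + 2) * V := by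
  constructor
  · calc (1 / 2 : ℝ) ^ (L + 2) * V = (1 / 2 : ℝ) ^ (L + 1) / 2 * V := by rw [pow_succ]; ring
      _ ≤ X := h.1
  · calc X ≤ 2 * (2 : ℝ) ^ (L + 1) * V := h.2
      _ = (2 : ℝ) ^ (L + 2) * V := by rw [pow_succ]; ring

/-! ## 1. Level-`0` U-points -/

/-- **U-points** `j ≤ n` of the `(L+2)`-level system. [folklore] -/
theorem stepP_U (hn : 2 ≤ n) (hB : 16 * ((n + 2 : ℕ) : ℝ) ^ 2 ≤ B) {L : ℕ} (hBL : 8 * ((n + 2 : ℕ) : ℝ) ^ 2 * 4 ^ L ≤ B)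
    (I0 : INVf n B L) (I1 : INVf n B (L + 1)) {j : ℕ} (hjn : j ≤ n) :
    (1 / 2 : ℝ) ^ (L + 2) * Vv n B (L + 2) j ≤ ss n (L + 2) j * fL n B (L + 2) (tp n B (L + 2) j) ∧
      ss n (L + 2) j * fL n B (L + 2) (tp n B (L + 2) j) ≤ (2 : ℝ) ^ (L + 2) * Vv n B (L + 2) j := by
  obtain ⟨hB1, h8, -⟩ := hB16 hB
  have hB0 : 0 < B := lt_trans zero_lt_one hB1
  have hn' : (2 : ℤ) ≤ n := by exact_mod_cast hn
  have hj3 : j < 3 * n := by omega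
  have hjn' : (j : ℤ) ≤ n := by exact_mod_cast hjn
  rw [tp_lt3 n B L j hj3, (tau_level (B := B) hn j hj3).1 (by omega), Vv_U n B L j hj3 hjn]
  set x : ℤ := 2 * (j : ℤ) - 1 with hx
  rw [fL_rec hB0.ne' L (B ^ x)]
  set u : ℝ := B ^ (-(sg n : ℤ)) * B ^ x with hu
  set u' : ℝ := B ^ (-(sg n : ℤ)) * u with hu'
  have hux : u = B ^ (x - sg n) := u_zpow hB0 x
  have hu0 : 0 < u := by rw [hux]; exact zpow_pos hB0 _
  have hu1 : u ≤ B ^ (-1 : ℤ) := by rw [hux]; exact zpow_le_zpow_right₀ hB1.le (by rw [sg_cast]; linarith)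
  have hu'0 : 0 < u' := mul_pos (zpow_pos hB0 _) hu0
  have hu'1 : u' ≤ B ^ (-1 : ℤ) := (shift_le hB1 hu0.le).trans hu1
  have htx : (0 : ℝ) < B ^ x := zpow_pos hB0 _
  -- certified factor `a(B^x) ≈ s^a_j B^{ea_j(x)}`
  have Ha : ∀ l : Fin (n + 2), l ≠ (⟨j, by omega⟩ : Fin (n + 2)) → ea n l x + 1 ≤ ea n (⟨j, by omega⟩ : Fin (n + 2)) x := by
    intro l hl
    rcases Nat.eq_zero_or_pos j with h0 | hj0
    · subst h0
      have : x = -1 := by rw [hx]; ring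
      rw [this]; exact ea_low_dom hn (Nat.one_le_iff_ne_zero.2 fun h => hl (Fin.ext h)) (val_le l)
    · exact ea_blk_dom hn hj0 hjn (val_le l) (fun h => hl (Fin.ext h))
  have cP := cert_of_dom h8 hB0 (fun l => abs_saR_le n l) (haF n) (dF n) htx ⟨j, by omega⟩
    (dom_zpow hB1 _ _ _ x ⟨j, by omega⟩ fun l hl => Or.inr (Ha l hl))
  rw [tv_ea hB0] at cP
  have hF := I1 u hu0 hu1
  have hb : |fb n B (B ^ x)| ≤ ((n + 2 : ℕ) : ℝ) * B ^ (eb n 1 x) :=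
    abs_bnom_le hB0 (fun l => abs_sbR_le n l) (hbF n) (dF n) htx (zpow_pos hB0 _).le
      (belowB_low hB (by linarith) htx.le le_rfl)
  have hf0 : |fL n B L u'| ≤ (2 : ℝ) ^ L * B ^ ((L : ℤ) * qa n) :=
    abs_le_of_signed (abs_sflat n L) (by positivity) (I0 u' hu'0 hu'1)
  have hE : |-(ss n (L + 2) j) * ((B ^ (-(dlt n : ℤ)) * fb n B (B ^ x)) ^ 2 * fL n B L u')| ≤
      (1 / 2 : ℝ) ^ (L + 1) * (B ^ (ea n (⟨j, by omega⟩ : Fin (n + 2)) x) * B ^ (((L + 1 : ℕ) : ℤ) * qa n)) / 4 := by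
    have hss : |ss n (L + 2) j| = 1 := by
      rw [ss_U n L j hj3 hjn, abs_mul, abs_mul, abs_sflat, abs_pow, abs_neg_one_pow', one_pow, mul_one, mul_one]
      unfold saR; split_ifs <;> simp
    rw [abs_mul, abs_neg, hss, one_mul, abs_mul, abs_pow, abs_mul, abs_of_pos (zpow_pos hB0 _)]
    have h1 : (B ^ (-(dlt n : ℤ)) * |fb n B (B ^ x)|) ^ 2 * |fL n B L u'| ≤
        (B ^ (-(dlt n : ℤ)) * (((n + 2 : ℕ) : ℝ) * B ^ (eb n 1 x))) ^ 2 * ((2 : ℝ) ^ L * B ^ ((L : ℤ) * qa n)) :=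
      mul_le_mul (pow_le_pow_left₀ (by positivity) (mul_le_mul_of_nonneg_left hb (zpow_pos hB0 _).le) 2) hf0
        (abs_nonneg _) (by positivity)
    refine h1.trans ?_
    rw [q0_reshape hB0]
    refine errU_bound hB1 hBL ?_
    rcases Nat.eq_zero_or_pos j with h0 | hj0
    · subst h0
      have := gap0_low hn
      have e : x = -1 := by rw [hx]; ring
      dsimp only; rw [e, ea_zero]; rw [ea_zero] at this; linarith
    · have := gap0_blkA (n := n) hj0 hjn; dsimp only; linarith
  have hsa : |saF n ⟨j, by omega⟩| = 1 := abs_saR_eq n _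
  have h := stepU_real (zpow_pos hB0 _) (by positivity) (by positivity) hsa cP hF hE
  have hg2 := gpow_sq n (L + 1)
  have vj : saF n ⟨j, by omega⟩ = saR n j := rfl
  have key : ss n (L + 2) j * (fa n B (B ^ x) * (((-1 : ℝ) ^ n) ^ (L + 1) * fL n B (L + 1) u) -
      (B ^ (-(dlt n : ℤ)) * fb n B (B ^ x)) ^ 2 * fL n B L u') =
      saF n ⟨j, by omega⟩ * sflat n (L + 1) * (fa n B (B ^ x) * fL n B (L + 1) u) +
        -(ss n (L + 2) j) * ((B ^ (-(dlt n : ℤ)) * fb n B (B ^ x)) ^ 2 * fL n B L u') := by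
    rw [ss_U n L j hj3 hjn, vj]
    linear_combination (saR n j * sflat n (L + 1) * (fa n B (B ^ x) * fL n B (L + 1) u)) * hg2
  rw [key]
  exact bounds_rescale L h

/-! ## 2. Level-`0` strong-link points -/

/-- **W-points** `j = n + 2w − 1` (`1 ≤ w ≤ n`) of the `(L+2)`-level system. [folklore] -/
theorem stepP_W (hn : 2 ≤ n) (hB : 16 * ((n + 2 : ℕ) : ℝ) ^ 2 ≤ B) {L : ℕ} (hBL : 8 * ((n + 2 : ℕ) : ℝ) ^ 2 * 4 ^ L ≤ B)
    (I0 : INVf n B L) (I1 : INVf n B (L + 1)) {w : ℕ} (hw1 : 1 ≤ w) (hwn : w ≤ n) :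
    let j := n + 2 * w - 1
    (1 / 2 : ℝ) ^ (L + 2) * Vv n B (L + 2) j ≤ ss n (L + 2) j * fL n B (L + 2) (tp n B (L + 2) j) ∧
      ss n (L + 2) j * fL n B (L + 2) (tp n B (L + 2) j) ≤ (2 : ℝ) ^ (L + 2) * Vv n B (L + 2) j := by
  intro j
  obtain ⟨hB1, h8, -⟩ := hB16 hB
  have hB0 : 0 < B := lt_trans zero_lt_one hB1
  have hn' : (2 : ℤ) ≤ n := by exact_mod_cast hn
  have hw1' : (1 : ℤ) ≤ w := by exact_mod_cast hw1
  have hwn' : (w : ℤ) ≤ n := by exact_mod_cast hwn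
  have hj : j = n + 2 * w - 1 := rfl
  have hj3 : j < 3 * n := by omega
  set x : ℤ := 2 * (n : ℤ) + 2 * w - 1 with hx
  have htp : tp n B (L + 2) j = B ^ x := by
    rw [tp_lt3 n B L j hj3]
    by_cases hj1 : j ≤ n + 1
    · rw [(tau_level (B := B) hn j hj3).1 hj1]; congr 1; rw [hx]; omega
    · rw [(tau_level (B := B) hn j hj3).2.2 (by omega) (by omega)]; congr 1; rw [hx]; omega
  have hss : ss n (L + 2) j = -sflat n L := ss_W n L j hj3 (by omega) (by omega)
  have hVv : Vv n B (L + 2) j = B ^ (2 * (eb n w x - (dlt n : ℤ))) * B ^ (((L : ℕ) : ℤ) * qa n) := by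
    rw [Vv_W n B L j hj3 (by omega) (by omega), show (j - n + 1) / 2 = w by omega,
      show ((j : ℤ) + n) = x by rw [hx, hj]; omega]
  rw [htp, hss, hVv, fL_rec hB0.ne' L (B ^ x)]
  set u : ℝ := B ^ (-(sg n : ℤ)) * B ^ x with hu
  set u' : ℝ := B ^ (-(sg n : ℤ)) * u with hu'
  have hux : u = B ^ (x - sg n) := u_zpow hB0 x
  have hu0 : 0 < u := by rw [hux]; exact zpow_pos hB0 _
  have hu1 : u ≤ B ^ (-1 : ℤ) := by rw [hux]; exact zpow_le_zpow_right₀ hB1.le (by rw [sg_cast]; linarith)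
  have hu'0 : 0 < u' := mul_pos (zpow_pos hB0 _) hu0
  have hu'1 : u' ≤ B ^ (-1 : ℤ) := (shift_le hB1 hu0.le).trans hu1
  have htx : (0 : ℝ) < B ^ x := zpow_pos hB0 _
  -- certified strong link
  have hsw : |sbF n ⟨w, by omega⟩| = 1 := by show |sbR n w| = 1; exact abs_sbR_blk hw1 hwn
  have cQ := cert_zsmul (zpow_pos hB0 (-(dlt n : ℤ))) (cert_of_dom h8 hB0 (fun l => abs_sbR_le n l) (hbF n) (dF n) htx
    ⟨w, by omega⟩ (dom_zpow hB1 _ _ _ x ⟨w, by omega⟩ fun l hl => by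
      rcases cases_v (val_le l) with h0 | ⟨h1, h2⟩ | htop
      · exact Or.inl (sbR_off (Or.inl h0))
      · exact Or.inr (eb_blk_dom hw1 hwn h1 h2 (fun h => hl (Fin.ext h)))
      · exact Or.inl (sbR_off (Or.inr htop))))
  rw [tv_eb hB0, ← zpow_add₀ hB0.ne', show -(dlt n : ℤ) + eb n (⟨w, by omega⟩ : Fin (n + 2)) x = eb n w x - dlt n by
    ring] at cQ
  -- inner flat two levels down, error = a-term times flat one level down
  have hF := I0 u' hu'0 hu'1
  have ha : |fa n B (B ^ x)| ≤ ((n + 2 : ℕ) : ℝ) * B ^ (ea n n x) :=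
    abs_bnom_le hB0 (fun l => abs_saR_le n l) (haF n) (dF n) htx (zpow_pos hB0 _).le
      (below_zpow hB1 _ _ _ x _ fun l => Or.inr (by
        change ea n l x ≤ ea n n x
        by_cases hl : (l : ℕ) = n
        · rw [hl]
        · linarith [ea_n_dom hn hw1 hwn (val_le l) hl]))
  have hf1 : |fL n B (L + 1) u| ≤ (2 : ℝ) ^ (L + 1) * B ^ (((L + 1 : ℕ) : ℤ) * qa n) :=
    abs_le_of_signed (abs_sflat n (L + 1)) (by positivity) (I1 u hu0 hu1)
  have hE : |-(sflat n L) * (((-1 : ℝ) ^ n) ^ (L + 1)) * (fa n B (B ^ x) * fL n B (L + 1) u)| ≤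
      (1 / 2 : ℝ) ^ L * ((B ^ (eb n w x - dlt n)) ^ 2 * B ^ ((L : ℤ) * qa n)) / 4 := by
    rw [abs_mul, abs_mul, abs_neg, abs_sflat, abs_pow, abs_neg_one_pow', one_pow, one_mul, one_mul, abs_mul]
    exact (mul_le_mul ha hf1 (abs_nonneg _) (by positivity)).trans (errW_bound hB1 hBL (gap0_W hn hw1 hwn))
  have h := stepW_real (zpow_pos hB0 _) (by positivity) (by positivity) hsw cQ hF hE
  have key : -sflat n L * (fa n B (B ^ x) * (((-1 : ℝ) ^ n) ^ (L + 1) * fL n B (L + 1) u) -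
      (B ^ (-(dlt n : ℤ)) * fb n B (B ^ x)) ^ 2 * fL n B L u') =
      (B ^ (-(dlt n : ℤ)) * fb n B (B ^ x)) ^ 2 * (sflat n L * fL n B L u') +
        -(sflat n L) * (((-1 : ℝ) ^ n) ^ (L + 1)) * (fa n B (B ^ x) * fL n B (L + 1) u) := by ring
  rw [key]
  have e2 : B ^ (2 * (eb n w x - (dlt n : ℤ))) * B ^ ((L : ℤ) * qa n) = (B ^ (eb n w x - dlt n)) ^ 2 * B ^ ((L : ℤ) * qa n) := by
    rw [← zpow_natCast (B ^ (eb n w x - dlt n)) 2, ← zpow_mul]; congr 2; push_cast; ring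
  rw [show (((L : ℕ) : ℤ)) = (L : ℤ) from rfl, e2]
  constructor
  · calc (1 / 2 : ℝ) ^ (L + 2) * ((B ^ (eb n w x - dlt n)) ^ 2 * B ^ ((L : ℤ) * qa n))
        = (1 / 2 : ℝ) ^ L / 4 * ((B ^ (eb n w x - dlt n)) ^ 2 * B ^ ((L : ℤ) * qa n)) := by rw [pow_succ, pow_succ]; ring
      _ ≤ _ := h.1
  · calc _ ≤ 2 * (2 : ℝ) ^ L * ((B ^ (eb n w x - dlt n)) ^ 2 * B ^ ((L : ℤ) * qa n)) := h.2
      _ ≤ (2 : ℝ) ^ (L + 2) * ((B ^ (eb n w x - dlt n)) ^ 2 * B ^ ((L : ℤ) * qa n)) := by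
          refine mul_le_mul_of_nonneg_right ?_ (by positivity)
          rw [pow_succ, pow_succ]; nlinarith [pow_pos (show (0:ℝ) < 2 by norm_num) L]

/-! ## 3. Level-`0` bracketed zeros (square splitting) -/

/-- **bracket points** `j = n + 2w` (`1 ≤ w ≤ n − 1`) of the `(L+2)`-level system. [folklore] -/
theorem stepP_I (hn : 2 ≤ n) (hB : 16 * ((n + 2 : ℕ) : ℝ) ^ 2 ≤ B) {L : ℕ} (I1 : INVf n B (L + 1))
    {w : ℕ} (hw1 : 1 ≤ w) (hwn : w + 1 ≤ n) :
    let j := n + 2 * w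
    (1 / 2 : ℝ) ^ (L + 2) * Vv n B (L + 2) j ≤ ss n (L + 2) j * fL n B (L + 2) (tp n B (L + 2) j) ∧
      ss n (L + 2) j * fL n B (L + 2) (tp n B (L + 2) j) ≤ (2 : ℝ) ^ (L + 2) * Vv n B (L + 2) j := by
  intro j
  obtain ⟨hB1, h8, hB4⟩ := hB16 hB
  have hB0 : 0 < B := lt_trans zero_lt_one hB1
  have hn' : (2 : ℤ) ≤ n := by exact_mod_cast hn
  have hj : j = n + 2 * w := rfl
  have hj3 : j < 3 * n := by omega
  have htp : tp n B (L + 2) j = bz n B w := by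
    rw [tp_lt3 n B L j hj3, (tau_level (B := B) hn j hj3).2.1 (by omega) (by omega), show (j - n) / 2 = w by omega]
  have hss : ss n (L + 2) j = ((-1 : ℝ) ^ n) ^ (L + 1) * sflat n (L + 1) := ss_I n L j hj3 (by omega) (by omega)
  have hVv : Vv n B (L + 2) j = tv B (haF n ⟨n, by omega⟩) (dF n ⟨n, by omega⟩) (bz n B w) * B ^ (((L + 1 : ℕ) : ℤ) * qa n) := by
    rw [Vv_I n B L j hj3 (by omega) (by omega), show (j - n) / 2 = w by omega]
  rw [htp, hss, hVv]
  obtain ⟨b1, b2, b0⟩ := bz_spec hB4 (w := w) hw1 hwn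
  set t := bz n B w with ht
  have ht0 : 0 < t := lt_trans (zpow_pos hB0 _) b1
  rw [fL_rec hB0.ne' L t, b0, mul_zero, zero_pow two_ne_zero, zero_mul, sub_zero]
  set u : ℝ := B ^ (-(sg n : ℤ)) * t with hu
  have hu0 : 0 < u := mul_pos (zpow_pos hB0 _) ht0
  have hu1 : u ≤ B ^ (-1 : ℤ) := by
    have h1 : u ≤ B ^ (-(sg n : ℤ)) * B ^ (2 * (n : ℤ) + 2 * (w + 1 : ℕ) - 1) :=
      mul_le_mul_of_nonneg_left b2.le (zpow_pos hB0 _).le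
    rw [← zpow_add₀ hB0.ne'] at h1
    exact h1.trans (zpow_le_zpow_right₀ hB1.le (by rw [sg_cast]; push_cast; omega))
  have cP := cert_of_dom h8 hB0 (fun l => abs_saR_le n l) (haF n) (dF n) ht0 ⟨n, by omega⟩
    (domA_bracket hn hB4 hw1 hwn b1.le b2.le)
  have hF := I1 u hu0 hu1
  have hE : |(0 : ℝ)| ≤ (1 / 2 : ℝ) ^ (L + 1) *
      (tv B (haF n ⟨n, by omega⟩) (dF n ⟨n, by omega⟩) t * B ^ (((L + 1 : ℕ) : ℤ) * qa n)) / 4 := by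
    rw [abs_zero]; exact div_nonneg (mul_nonneg (by positivity) (mul_nonneg (tv_pos hB0 _ _ ht0).le (zpow_pos hB0 _).le)) (by norm_num)
  have hsa : |saF n ⟨n, by omega⟩| = 1 := abs_saR_eq n _
  have h := stepU_real (tv_pos hB0 _ _ ht0) (zpow_pos hB0 _) (by positivity) hsa cP hF hE
  have v5 : saF n ⟨n, by omega⟩ = 1 := (sign_values (n := n) (by omega)).2.2.2.2
  have hg2 := gpow_sq n (L + 1)
  have key : ((-1 : ℝ) ^ n) ^ (L + 1) * sflat n (L + 1) * (fa n B t * (((-1 : ℝ) ^ n) ^ (L + 1) * fL n B (L + 1) u)) =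
      saF n ⟨n, by omega⟩ * sflat n (L + 1) * (fa n B t * fL n B (L + 1) u) + 0 := by
    rw [v5]; linear_combination (sflat n (L + 1) * (fa n B t * fL n B (L + 1) u)) * hg2
  rw [key]
  exact bounds_rescale L h

/-! ## 4. The late-point core -/

/-- **late core**: at `t = B^σ u`, `u` the `j'`-th point of the `(L+1)`-system, the `(L+2)`-bounds follow from the `(L+1)`-bounds at
`j'`, an error bound `|fL L (u/B^σ)| ≤ 2^L R` and the gap `8K²4^L · (B^{−δ})² b-bound² · R ≤ a_{top}(t) · Vv (L+1) j'`. [folklore] -/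
theorem late_core (hn : 2 ≤ n) (hB : 16 * ((n + 2 : ℕ) : ℝ) ^ 2 ≤ B) {L j' : ℕ} {u R : ℝ}
    (hu : B ^ (-1 : ℤ) ≤ u) (htp : tp n B (L + 1) j' = u)
    (I1j : (1 / 2 : ℝ) ^ (L + 1) * Vv n B (L + 1) j' ≤ ss n (L + 1) j' * fL n B (L + 1) u ∧
      ss n (L + 1) j' * fL n B (L + 1) u ≤ (2 : ℝ) ^ (L + 1) * Vv n B (L + 1) j')
    (hss1 : |ss n (L + 1) j'| = 1) (hVpos : 0 < Vv n B (L + 1) j')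
    (hR : |fL n B L (B ^ (-(sg n : ℤ)) * u)| ≤ (2 : ℝ) ^ L * R)
    (hgap : (8 * ((n + 2 : ℕ) : ℝ) ^ 2 * 4 ^ L) *
      ((B ^ (-(dlt n : ℤ))) ^ 2 * (((n + 2 : ℕ) : ℝ) * tv B (hbF n ⟨n, by omega⟩) (dF n ⟨n, by omega⟩) (B ^ (sg n : ℤ) * u)) ^ 2 * R) ≤
      tv B (haF n (Fin.last (n + 1))) (dF n (Fin.last (n + 1))) (B ^ (sg n : ℤ) * u) * Vv n B (L + 1) j')
    {j : ℕ} (hj : ¬ j < 3 * n) (hjj : j - 3 * n = j') :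
    (1 / 2 : ℝ) ^ (L + 2) * Vv n B (L + 2) j ≤ ss n (L + 2) j * fL n B (L + 2) (tp n B (L + 2) j) ∧
      ss n (L + 2) j * fL n B (L + 2) (tp n B (L + 2) j) ≤ (2 : ℝ) ^ (L + 2) * Vv n B (L + 2) j := by
  obtain ⟨hB1, h8, -⟩ := hB16 hB
  have hB0 : 0 < B := lt_trans zero_lt_one hB1
  have hn' : (2 : ℤ) ≤ n := by exact_mod_cast hn
  have htpj : tp n B (L + 2) j = B ^ (sg n : ℤ) * u := by rw [tp_ge3 n B L j hj, hjj, htp]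
  rw [Vv_late n B L j hj, ss_late n L j hj, htpj, hjj]
  set t : ℝ := B ^ (sg n : ℤ) * u with ht
  have hu0 : 0 < u := lt_of_lt_of_le (zpow_pos hB0 _) hu
  have ht0 : 0 < t := mul_pos (zpow_pos hB0 _) hu0
  have ht1 : B ^ (4 * (n : ℤ) + 3) ≤ t := by
    have : B ^ (4 * (n : ℤ) + 3) = B ^ (sg n : ℤ) * B ^ (-1 : ℤ) := by rw [← zpow_add₀ hB0.ne', sg_cast]; ring_nf
    rw [this]; exact mul_le_mul_of_nonneg_left hu (zpow_pos hB0 _).le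
  have hut : B ^ (-(sg n : ℤ)) * t = u := by rw [ht, ← mul_assoc, ← zpow_add₀ hB0.ne', neg_add_cancel, zpow_zero, one_mul]
  rw [fL_rec hB0.ne' L t, hut]
  have cP := cert_of_dom h8 hB0 (fun l => abs_saR_le n l) (haF n) (dF n) ht0 (Fin.last (n + 1)) (domA_top hn hB le_rfl ht1)
  -- error
  have hb : |fb n B t| ≤ ((n + 2 : ℕ) : ℝ) * tv B (hbF n ⟨n, by omega⟩) (dF n ⟨n, by omega⟩) t := by
    refine abs_bnom_le hB0 (fun l => abs_sbR_le n l) (hbF n) (dF n) ht0 (tv_pos hB0 _ _ ht0).le fun l => ?_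
    rcases cases_v (val_le l) with h0 | ⟨h1, h2⟩ | htop
    · exact Or.inl (sbR_off (Or.inl h0))
    · right
      have hx : B ^ (4 * (n : ℤ) - 1) ≤ t := le_trans (zpow_le_zpow_right₀ hB1.le (by linarith)) ht1
      have H := below_zpow hB1 (sbF n) (hbF n) (dF n) (4 * (n : ℤ) - 1) _ (Hb_high (4 * (n : ℤ) - 1) le_rfl) l
      rcases H with h0 | H
      · exact absurd (show sbR n l = 0 from h0) (by rw [sbR_blk h1 h2]; simp)
      · rw [← tv_eb hB0 ⟨n, by omega⟩] at H
        have := mono_cmp_right (c₁ := B ^ hbF n l) (c₂ := B ^ hbF n ⟨n, by omega⟩) (zpow_pos hB0 _).le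
          ((dF_strictMono (n := n) (by omega)).monotone (show l ≤ ⟨n, by omega⟩ from Fin.mk_le_mk.mpr h2 |>.trans' le_rfl))
          (zpow_pos hB0 _) hx H
        exact this
    · exact Or.inl (sbR_off (Or.inr htop))
  have hE : |-(((-1 : ℝ) ^ n) ^ (L + 1) * ss n (L + 1) j') * ((B ^ (-(dlt n : ℤ)) * fb n B t) ^ 2 * fL n B L (B ^ (-(sg n : ℤ)) * u))| ≤
      (1 / 2 : ℝ) ^ (L + 1) * (tv B (haF n (Fin.last (n + 1))) (dF n (Fin.last (n + 1))) t * Vv n B (L + 1) j') / 4 := by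
    rw [abs_mul, abs_neg, abs_mul, abs_pow, abs_neg_one_pow', one_pow, one_mul, hss1, one_mul, abs_mul, abs_pow, abs_mul,
      abs_of_pos (zpow_pos hB0 _)]
    have h1 : (B ^ (-(dlt n : ℤ)) * |fb n B t|) ^ 2 * |fL n B L (B ^ (-(sg n : ℤ)) * u)| ≤
        (B ^ (-(dlt n : ℤ)) * (((n + 2 : ℕ) : ℝ) * tv B (hbF n ⟨n, by omega⟩) (dF n ⟨n, by omega⟩) t)) ^ 2 * ((2 : ℝ) ^ L * R) :=
      mul_le_mul (pow_le_pow_left₀ (by positivity) (mul_le_mul_of_nonneg_left hb (zpow_pos hB0 _).le) 2) hR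
        (abs_nonneg _) (by positivity)
    refine h1.trans ?_
    have hR0 : 0 ≤ R := by
      have := (abs_nonneg _).trans hR
      nlinarith [pow_pos (show (0:ℝ) < 2 by norm_num) L]
    -- use the gap: multiply by 8·4^L·K² ≤ ... and 2^L (2^{L+1}·4) = 8·4^L
    rw [one_div_pow, show (1 : ℝ) / 2 ^ (L + 1) * (tv B (haF n (Fin.last (n + 1))) (dF n (Fin.last (n + 1))) t * Vv n B (L + 1) j') / 4
      = (tv B (haF n (Fin.last (n + 1))) (dF n (Fin.last (n + 1))) t * Vv n B (L + 1) j') / (2 ^ (L + 1) * 4) by field_simp]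
    rw [le_div_iff₀ (by positivity), mul_pow]
    calc (B ^ (-(dlt n : ℤ))) ^ 2 * (((n + 2 : ℕ) : ℝ) * tv B (hbF n ⟨n, by omega⟩) (dF n ⟨n, by omega⟩) t) ^ 2 * (2 ^ L * R) * (2 ^ (L + 1) * 4)
        = (2 ^ L * (2 ^ (L + 1) * 4)) * ((B ^ (-(dlt n : ℤ))) ^ 2 * (((n + 2 : ℕ) : ℝ) * tv B (hbF n ⟨n, by omega⟩) (dF n ⟨n, by omega⟩) t) ^ 2 * R) := by ring
      _ = (8 * 4 ^ L) * ((B ^ (-(dlt n : ℤ))) ^ 2 * (((n + 2 : ℕ) : ℝ) * tv B (hbF n ⟨n, by omega⟩) (dF n ⟨n, by omega⟩) t) ^ 2 * R) := by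
          rw [two_pow_ident]
      _ ≤ (8 * ((n + 2 : ℕ) : ℝ) ^ 2 * 4 ^ L) * ((B ^ (-(dlt n : ℤ))) ^ 2 * (((n + 2 : ℕ) : ℝ) * tv B (hbF n ⟨n, by omega⟩) (dF n ⟨n, by omega⟩) t) ^ 2 * R) := by
          refine mul_le_mul_of_nonneg_right ?_ (by positivity)
          have hK1 : (1 : ℝ) ≤ ((n + 2 : ℕ) : ℝ) ^ 2 := one_le_pow₀ (by exact_mod_cast (show 1 ≤ n + 2 by omega))
          nlinarith [pow_pos (show (0:ℝ) < 4 by norm_num) L]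
      _ ≤ _ := hgap
  have hsa : |saF n (Fin.last (n + 1))| = 1 := abs_saR_eq n _
  have h := stepU_real (tv_pos hB0 _ _ ht0) hVpos (by positivity) hsa cP I1j hE
  have v3 : saF n (Fin.last (n + 1)) = 1 := (sign_values (n := n) (by omega)).2.2.1
  have hg2 := gpow_sq n (L + 1)
  have key : ((-1 : ℝ) ^ n) ^ (L + 1) * ss n (L + 1) j' *
      (fa n B t * (((-1 : ℝ) ^ n) ^ (L + 1) * fL n B (L + 1) u) - (B ^ (-(dlt n : ℤ)) * fb n B t) ^ 2 * fL n B L (B ^ (-(sg n : ℤ)) * u)) =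
      saF n (Fin.last (n + 1)) * ss n (L + 1) j' * (fa n B t * fL n B (L + 1) u) +
        -(((-1 : ℝ) ^ n) ^ (L + 1) * ss n (L + 1) j') * ((B ^ (-(dlt n : ℤ)) * fb n B t) ^ 2 * fL n B L (B ^ (-(sg n : ℤ)) * u)) := by
    rw [v3]; linear_combination (ss n (L + 1) j' * (fa n B t * fL n B (L + 1) u)) * hg2
  rw [key]
  exact bounds_rescale L h

end Summit.ValiantsHypothesis.ValiantsHypothesis.Theorems.LacunarySymmetroidMatrixDescartes.VSQ
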